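import Summits.Ventures.PercRepro.MSSplitCases
import Summits.Ventures.PercRepro.MSSplitSingle

/-!
# Step 4 of Theorem 10.1, part 2: the three sub-cases of case (ι)

proofs/P4-gen9.md §10, Step 4, case (ι): `A₅ ∈ T` and `A₃ ∉ S`, so `X* = A₁ ∪ A₃ ∪ A₅ ∈ s` and (★)
leaves `|rest| ≤ 1`. The three sub-cases, each ending in a member of `F` that is a difference or in
a cover (against no cover):
* `false_of_iota_classA2` (`a₂ ∈ A₂`): the rest is `{{a₂}}`; `b \ X*` and `b₀ \ a` contain `a₂`,
  so `A₄ = ∅ = A₅`; no cover puts some `x ∈ A₆` in some `a`, and `a \ b ∋ x` forces `A₃ ⊆ b`, so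
  `A₃ = ∅`; `A₁ = ∅` as `{a₁}` would be a second element; hence `X* = ∅`, a difference.
* `false_of_iota_classA1` (`a₁ ∈ A₁`): the rest is `{{a₁}}`; `X* \ b ∋ a₁` forces `A₃ = ∅`,
  `a \ b₀ ∋ a₁` forces `A₆ = ∅`; no cover gives `w ∈ A₄ ∩ b₁`, and the mixed `b₁ \ a` forces
  `A₅ = ∅`; hence `X* = A₁ = {a₁}`, a difference.
* `false_of_iota_empty` (`A₁ = A₂ = ∅`): all mixed good pairs coincide; with `x₀ ∈ A₅` missing `a`
  and `y₀ ∈ A₄` in `b`, `A₅ = {x₀}`, `A₄ = {y₀}`, and either `A₃ ≠ ∅` (then `A₆ = ∅` and `X* ∪ b`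
  covers) or `A₃ = ∅` (then `a ∩ b ⊆ A₅` misses `a`); with `A₄ = ∅` some `w ∈ A₆` exists and the
  trace of a member containing `z ∈ A₃` is `A₃`; with `A₅ = ∅` either `w ∈ A₆` forces `A₃ = {z}`
  against intersecting, or `A₆ = ∅` is the residual case `s = {X*}` of Step 5
  (`cover_of_single_side`).
-/

namespace PercRepro.MSTight

open Finset
open scoped FinsetFamily

variable {α : Type*} [DecidableEq α]

section CaseIota

variable {u : Finset α} {F s t : Finset (Finset α)}

/-- **Case (ι), `A₂ ≠ ∅`.** -/
theorem false_of_iota_classA2 (h : CoverHyp u F s t) (hnc : ∀ a ∈ F, ∀ b ∈ F, a ∪ b ≠ u)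
    {X : Finset α} (hX : X ∈ s) (hXtr : X ∩ (classA5 u s t ∪ classA6 u s t) = classA5 u s t)
    (hc : (rest u F s t).card ≤ 1) {a₂ : α} (ha₂ : a₂ ∈ classA2 u s t) : False := by
  have hXeq : X = classA1 u s t ∪ classA3 u s t ∪ classA5 u s t := by
    rw [mem_s_eq h hX, hXtr]
  have hs2 : ({a₂} : Finset α) ∈ rest u F s t :=
    mem_rest_of_mem_classA2 h (h.sing a₂ (mem_classA2.1 ha₂).1) ha₂ (Finset.mem_singleton_self a₂)
  have huniq : ∀ W ∈ rest u F s t, W = {a₂} := fun W hW => Finset.card_le_one.1 hc _ hW _ hs2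
  obtain ⟨b₀, hb₀⟩ := h.split.ne_t
  -- no member of `t` meets `A₄`
  have hA4 : ∀ b ∈ t, ∀ w ∈ classA4 u s t, w ∉ b := by
    intro b hb w hw hwb
    have hW : b \ X ∈ rest u F s t :=
      mem_rest_of_mem_classA2 h (sdiff_mem_diffs (mem_F_of_mem_t h hb) (mem_F_of_mem_s h hX)) ha₂
        (Finset.mem_sdiff.2 ⟨mem_of_mem_classA2 ha₂ hb, notMem_of_mem_classA2 ha₂ hX⟩)
    have hwW : w ∈ b \ X := Finset.mem_sdiff.2 ⟨hwb, notMem_of_mem_classA4 hw hX⟩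
    rw [huniq _ hW] at hwW
    rw [Finset.mem_singleton.1 hwW] at hw
    exact (notMem_halves_of_mem_classA2 h ha₂).2 (Finset.mem_union_right _ hw)
  have hA4e : ∀ w, w ∉ classA4 u s t := fun w hw => by
    obtain ⟨b, hb, hwb⟩ := exists_mem_of_mem_classA4 h hw
    exact hA4 b hb w hw hwb
  -- `A₅ ⊆ a` for every `a ∈ s`, so `A₅ = ∅`
  have hA5 : ∀ a ∈ s, ∀ x ∈ classA5 u s t, x ∈ a := by
    intro a ha x hx
    by_contra hxa
    have hW : b₀ \ a ∈ rest u F s t :=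
      mem_rest_of_mem_classA2 h (sdiff_mem_diffs (mem_F_of_mem_t h hb₀) (mem_F_of_mem_s h ha)) ha₂
        (Finset.mem_sdiff.2 ⟨mem_of_mem_classA2 ha₂ hb₀, notMem_of_mem_classA2 ha₂ ha⟩)
    have hxW : x ∈ b₀ \ a := Finset.mem_sdiff.2 ⟨mem_of_mem_classA5 hx hb₀, hxa⟩
    rw [huniq _ hW] at hxW
    rw [Finset.mem_singleton.1 hxW] at hx
    exact (notMem_halves_of_mem_classA2 h ha₂).1 (Finset.mem_union_left _ hx)
  have hA5e : ∀ x, x ∉ classA5 u s t := fun x hx => by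
    obtain ⟨a, ha, hxa⟩ := exists_notMem_of_mem_classA5 h hx
    exact hxa (hA5 a ha x hx)
  -- no cover for `X, b₀`: some `x ∈ A₆`, in some `a ∈ s`
  have hA6 : ∃ x, x ∈ classA6 u s t := by
    by_contra hno
    push Not at hno
    exact hnc X (mem_F_of_mem_s h hX) b₀ (mem_F_of_mem_t h hb₀) (union_eq_of_subsets h hX hb₀
      (fun x hx => absurd hx (hno x)) (fun w hw => absurd hw (hA4e w)))
  obtain ⟨x, hx⟩ := hA6
  obtain ⟨a, ha, hxa⟩ := exists_mem_of_mem_classA6 h hx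
  -- `A₃ ⊆ b` for every `b ∈ t` (the mixed `a \ b` would be a second element), so `A₃ = ∅`
  have hA3 : ∀ b ∈ t, ∀ z ∈ classA3 u s t, z ∈ b := by
    intro b hb z hz
    by_contra hzb
    have hW : a \ b ∈ rest u F s t :=
      mem_rest_of_mixed h (sdiff_mem_diffs (mem_F_of_mem_s h ha) (mem_F_of_mem_t h hb))
        (Finset.mem_sdiff.2 ⟨hxa, notMem_of_mem_classA6 hx hb⟩) (Finset.mem_union_right _ hx)
        (Finset.mem_sdiff.2 ⟨mem_of_mem_classA3 hz ha, hzb⟩) (Finset.mem_union_left _ hz)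
    have hzW : z ∈ a \ b := Finset.mem_sdiff.2 ⟨mem_of_mem_classA3 hz ha, hzb⟩
    rw [huniq _ hW] at hzW
    rw [Finset.mem_singleton.1 hzW] at hz
    exact (notMem_halves_of_mem_classA2 h ha₂).2 (Finset.mem_union_left _ hz)
  have hA3e : ∀ z, z ∉ classA3 u s t := fun z hz => by
    obtain ⟨b, hb, hzb⟩ := exists_notMem_of_mem_classA3 h hz
    exact hzb (hA3 b hb z hz)
  -- `A₁ = ∅` (a singleton `{a₁}` would be a second element)
  have hA1e : ∀ r, r ∉ classA1 u s t := fun r hr => by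
    have hs1 : ({r} : Finset α) ∈ rest u F s t :=
      mem_rest_of_mem_classA1 h (h.sing r (mem_classA1.1 hr).1) hr (Finset.mem_singleton_self r)
    rw [Finset.singleton_inj.1 (huniq _ hs1)] at hr
    exact Finset.disjoint_left.1 (disjoint_classA1_classA2 h) hr ha₂
  -- so `X = ∅ ∈ F`, but `∅` is a difference
  have hXe : X = ∅ := by
    rw [hXeq]
    apply Finset.eq_empty_of_forall_notMem
    intro r hr
    simp only [Finset.mem_union] at hr
    rcases hr with (h1 | h3) | h5
    · exact hA1e r h1
    · exact hA3e r h3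
    · exact hA5e r h5
  exact h.notMem X (mem_F_of_mem_s h hX) (by rw [hXe]; exact empty_mem_diffs h)

/-- **Case (ι), `A₁ ≠ ∅`.** -/
theorem false_of_iota_classA1 (h : CoverHyp u F s t) (hnc : ∀ a ∈ F, ∀ b ∈ F, a ∪ b ≠ u)
    {X : Finset α} (hX : X ∈ s) (hXtr : X ∩ (classA5 u s t ∪ classA6 u s t) = classA5 u s t)
    (hc : (rest u F s t).card ≤ 1) {a₁ : α} (ha₁ : a₁ ∈ classA1 u s t) : False := by
  have hXeq : X = classA1 u s t ∪ classA3 u s t ∪ classA5 u s t := by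
    rw [mem_s_eq h hX, hXtr]
  have hs1 : ({a₁} : Finset α) ∈ rest u F s t :=
    mem_rest_of_mem_classA1 h (h.sing a₁ (mem_classA1.1 ha₁).1) ha₁ (Finset.mem_singleton_self a₁)
  have huniq : ∀ W ∈ rest u F s t, W = {a₁} := fun W hW => Finset.card_le_one.1 hc _ hW _ hs1
  obtain ⟨b₀, hb₀⟩ := h.split.ne_t
  -- `A₃ ⊆ b` for every `b ∈ t` (`X \ b` contains `a₁`), so `A₃ = ∅`
  have hA3 : ∀ b ∈ t, ∀ z ∈ classA3 u s t, z ∈ b := by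
    intro b hb z hz
    by_contra hzb
    have hW : X \ b ∈ rest u F s t :=
      mem_rest_of_mem_classA1 h (sdiff_mem_diffs (mem_F_of_mem_s h hX) (mem_F_of_mem_t h hb)) ha₁
        (Finset.mem_sdiff.2 ⟨mem_of_mem_classA1 ha₁ hX, notMem_of_mem_classA1 ha₁ hb⟩)
    have hzW : z ∈ X \ b := Finset.mem_sdiff.2 ⟨mem_of_mem_classA3 hz hX, hzb⟩
    rw [huniq _ hW] at hzW
    rw [Finset.mem_singleton.1 hzW] at hz
    exact (notMem_halves_of_mem_classA1 h ha₁).2 (Finset.mem_union_left _ hz)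
  have hA3e : ∀ z, z ∉ classA3 u s t := fun z hz => by
    obtain ⟨b, hb, hzb⟩ := exists_notMem_of_mem_classA3 h hz
    exact hzb (hA3 b hb z hz)
  -- no member of `s` meets `A₆` (`a \ b₀` contains `a₁`), so `A₆ = ∅`
  have hA6 : ∀ a ∈ s, ∀ x ∈ classA6 u s t, x ∉ a := by
    intro a ha x hx hxa
    have hW : a \ b₀ ∈ rest u F s t :=
      mem_rest_of_mem_classA1 h (sdiff_mem_diffs (mem_F_of_mem_s h ha) (mem_F_of_mem_t h hb₀)) ha₁
        (Finset.mem_sdiff.2 ⟨mem_of_mem_classA1 ha₁ ha, notMem_of_mem_classA1 ha₁ hb₀⟩)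
    have hxW : x ∈ a \ b₀ := Finset.mem_sdiff.2 ⟨hxa, notMem_of_mem_classA6 hx hb₀⟩
    rw [huniq _ hW] at hxW
    rw [Finset.mem_singleton.1 hxW] at hx
    exact (notMem_halves_of_mem_classA1 h ha₁).1 (Finset.mem_union_right _ hx)
  have hA6e : ∀ x, x ∉ classA6 u s t := fun x hx => by
    obtain ⟨a, ha, hxa⟩ := exists_mem_of_mem_classA6 h hx
    exact hA6 a ha x hx hxa
  -- no cover for `X, b₀`: some `w ∈ A₄`, in some `b₁ ∈ t`
  have hA4 : ∃ w, w ∈ classA4 u s t := by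
    by_contra hno
    push Not at hno
    exact hnc X (mem_F_of_mem_s h hX) b₀ (mem_F_of_mem_t h hb₀) (union_eq_of_subsets h hX hb₀
      (fun x hx => absurd hx (hA6e x)) (fun w hw => absurd hw (hno w)))
  obtain ⟨w, hw⟩ := hA4
  obtain ⟨b₁, hb₁, hwb₁⟩ := exists_mem_of_mem_classA4 h hw
  -- `A₅ ⊆ a` for every `a ∈ s` (the mixed `b₁ \ a` would be a second element), so `A₅ = ∅`
  have hA5 : ∀ a ∈ s, ∀ x ∈ classA5 u s t, x ∈ a := by
    intro a ha x hx
    by_contra hxa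
    have hW : b₁ \ a ∈ rest u F s t :=
      mem_rest_of_mixed h (sdiff_mem_diffs (mem_F_of_mem_t h hb₁) (mem_F_of_mem_s h ha))
        (Finset.mem_sdiff.2 ⟨mem_of_mem_classA5 hx hb₁, hxa⟩) (Finset.mem_union_left _ hx)
        (Finset.mem_sdiff.2 ⟨hwb₁, notMem_of_mem_classA4 hw ha⟩) (Finset.mem_union_right _ hw)
    have hxW : x ∈ b₁ \ a := Finset.mem_sdiff.2 ⟨mem_of_mem_classA5 hx hb₁, hxa⟩
    rw [huniq _ hW] at hxW
    rw [Finset.mem_singleton.1 hxW] at hx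
    exact (notMem_halves_of_mem_classA1 h ha₁).1 (Finset.mem_union_left _ hx)
  have hA5e : ∀ x, x ∉ classA5 u s t := fun x hx => by
    obtain ⟨a, ha, hxa⟩ := exists_notMem_of_mem_classA5 h hx
    exact hxa (hA5 a ha x hx)
  -- `X = A₁ = {a₁}`, a singleton difference in `F`
  have hXe : X = {a₁} := by
    rw [hXeq, Finset.eq_singleton_iff_unique_mem]
    refine ⟨Finset.mem_union_left _ (Finset.mem_union_left _ ha₁), fun r hr => ?_⟩
    simp only [Finset.mem_union] at hr
    rcases hr with (h1 | h3) | h5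
    · exact Finset.card_le_one.1 (card_classA1_le_one h) _ h1 _ ha₁
    · exact absurd h3 (hA3e r)
    · exact absurd h5 (hA5e r)
  exact h.notMem X (mem_F_of_mem_s h hX) (by rw [hXe]; exact h.sing a₁ (mem_classA1.1 ha₁).1)

/-- **Case (ι), `A₁ = A₂ = ∅`.** -/
theorem false_of_iota_empty (h : CoverHyp u F s t) (hnc : ∀ a ∈ F, ∀ b ∈ F, a ∪ b ≠ u)
    {X : Finset α} (hX : X ∈ s) (hXtr : X ∩ (classA5 u s t ∪ classA6 u s t) = classA5 u s t)
    (hc : (rest u F s t).card ≤ 1)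
    (hS : classA3 u s t ∉ t.image (fun b => b ∩ (classA3 u s t ∪ classA4 u s t)))
    (hA1e : ∀ r, r ∉ classA1 u s t) (hA2e : ∀ r, r ∉ classA2 u s t) : False := by
  have hXeq : X = classA1 u s t ∪ classA3 u s t ∪ classA5 u s t := by
    rw [mem_s_eq h hX, hXtr]
  have hXmem : ∀ r, r ∈ X ↔ r ∈ classA3 u s t ∨ r ∈ classA5 u s t := by
    intro r
    rw [hXeq]
    simp only [Finset.mem_union]
    constructor
    · rintro ((h1 | h3) | h5)
      · exact absurd h1 (hA1e r)
      · exact Or.inl h3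
      · exact Or.inr h5
    · rintro (h3 | h5)
      · exact Or.inl (Or.inr h3)
      · exact Or.inr h5
  obtain ⟨b₀, hb₀⟩ := h.split.ne_t
  by_cases h5 : ∃ x, x ∈ classA5 u s t
  · obtain ⟨x₀, hx₀⟩ := h5
    obtain ⟨a, ha, hx₀a⟩ := exists_notMem_of_mem_classA5 h hx₀
    by_cases h4 : ∃ y, y ∈ classA4 u s t
    · -- (c1): `A₅ = {x₀}`, `A₄ = {y₀}`
      obtain ⟨y₀, hy₀⟩ := h4
      obtain ⟨b, hb, hy₀b⟩ := exists_mem_of_mem_classA4 h hy₀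
      have hW0 : b \ a ∈ F \\ F := sdiff_mem_diffs (mem_F_of_mem_t h hb) (mem_F_of_mem_s h ha)
      have hx₀W : x₀ ∈ b \ a := Finset.mem_sdiff.2 ⟨mem_of_mem_classA5 hx₀ hb, hx₀a⟩
      have hy₀W : y₀ ∈ b \ a := Finset.mem_sdiff.2 ⟨hy₀b, notMem_of_mem_classA4 hy₀ ha⟩
      have hA5u : ∀ x ∈ classA5 u s t, x = x₀ := by
        intro x hx
        obtain ⟨a', ha', hxa'⟩ := exists_notMem_of_mem_classA5 h hx
        exact (pair_eq_of_card_rest_le_one h hc (sdiff_mem_diffs (mem_F_of_mem_t h hb) (mem_F_of_mem_s h ha')) hW0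
          (Finset.mem_sdiff.2 ⟨mem_of_mem_classA5 hx hb, hxa'⟩)
          (Finset.mem_sdiff.2 ⟨hy₀b, notMem_of_mem_classA4 hy₀ ha'⟩) hx₀W hy₀W
          (Finset.mem_union_left _ hx) (Finset.mem_union_right _ hy₀)
          (Finset.mem_union_left _ hx₀) (Finset.mem_union_right _ hy₀)).1
      have hA4u : ∀ y ∈ classA4 u s t, y = y₀ := by
        intro y hy
        obtain ⟨b', hb', hyb'⟩ := exists_mem_of_mem_classA4 h hy
        exact (pair_eq_of_card_rest_le_one h hc (sdiff_mem_diffs (mem_F_of_mem_t h hb') (mem_F_of_mem_s h ha)) hW0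
          (Finset.mem_sdiff.2 ⟨mem_of_mem_classA5 hx₀ hb', hx₀a⟩)
          (Finset.mem_sdiff.2 ⟨hyb', notMem_of_mem_classA4 hy ha⟩) hx₀W hy₀W
          (Finset.mem_union_left _ hx₀) (Finset.mem_union_right _ hy)
          (Finset.mem_union_left _ hx₀) (Finset.mem_union_right _ hy₀)).2
      by_cases h3 : ∃ z, z ∈ classA3 u s t
      · obtain ⟨z, hz⟩ := h3
        -- `A₆ = ∅`: a mixed pair `{w, z}` would force `w = x₀ ∈ A₅ ∩ A₆`
        have hA6e : ∀ w, w ∉ classA6 u s t := by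
          intro w hw
          obtain ⟨b', hb', hzb'⟩ := exists_notMem_of_mem_classA3 h hz
          obtain ⟨a'', ha'', hwa''⟩ := exists_mem_of_mem_classA6 h hw
          have e := (pair_eq_of_card_rest_le_one h hc (sdiff_mem_diffs (mem_F_of_mem_s h ha'') (mem_F_of_mem_t h hb')) hW0
            (Finset.mem_sdiff.2 ⟨hwa'', notMem_of_mem_classA6 hw hb'⟩)
            (Finset.mem_sdiff.2 ⟨mem_of_mem_classA3 hz ha'', hzb'⟩) hx₀W hy₀W
            (Finset.mem_union_right _ hw) (Finset.mem_union_left _ hz)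
            (Finset.mem_union_left _ hx₀) (Finset.mem_union_right _ hy₀)).1
          rw [e] at hw
          exact not_mem_classA5_and_classA6 h hx₀ hw
        exact hnc X (mem_F_of_mem_s h hX) b (mem_F_of_mem_t h hb) (union_eq_of_subsets h hX hb
          (fun w hw => absurd hw (hA6e w)) (fun y hy => by rw [hA4u y hy]; exact hy₀b))
      · -- `A₃ = ∅`: `a ∩ b` lies in `A₅ = {x₀}`, but `x₀ ∉ a`
        push Not at h3
        obtain ⟨y, hy⟩ := inter_nonempty h ha hb
        obtain ⟨hya, hyb⟩ := Finset.mem_inter.1 hy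
        have hyu : y ∈ u := h.support a (mem_F_of_mem_s h ha) hya
        rcases mem_classes h hyu with h1 | h2 | h3' | h4' | h5' | h6'
        · exact hA1e y h1
        · exact hA2e y h2
        · exact h3 y h3'
        · exact notMem_of_mem_classA4 h4' ha hya
        · rw [hA5u y h5'] at hya; exact hx₀a hya
        · exact notMem_of_mem_classA6 h6' hb hyb
    · -- (c2): `A₄ = ∅`, so some `w ∈ A₆` (no cover for `X, b₀`)
      push Not at h4
      have hA6 : ∃ w, w ∈ classA6 u s t := by
        by_contra hno
        push Not at hno
        exact hnc X (mem_F_of_mem_s h hX) b₀ (mem_F_of_mem_t h hb₀) (union_eq_of_subsets h hX hb₀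
          (fun w hw => absurd hw (hno w)) (fun y hy => absurd hy (h4 y)))
      obtain ⟨w, hw⟩ := hA6
      obtain ⟨a', ha', hwa'⟩ := exists_mem_of_mem_classA6 h hw
      by_cases h3 : ∃ z, z ∈ classA3 u s t
      · obtain ⟨z, hz⟩ := h3
        obtain ⟨b', hb', hzb'⟩ := exists_notMem_of_mem_classA3 h hz
        have hW0 : a' \ b' ∈ F \\ F :=
          sdiff_mem_diffs (mem_F_of_mem_s h ha') (mem_F_of_mem_t h hb')
        have hwW : w ∈ a' \ b' := Finset.mem_sdiff.2 ⟨hwa', notMem_of_mem_classA6 hw hb'⟩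
        have hzW : z ∈ a' \ b' := Finset.mem_sdiff.2 ⟨mem_of_mem_classA3 hz ha', hzb'⟩
        have hA3u : ∀ z' ∈ classA3 u s t, z' = z := by
          intro z' hz'
          obtain ⟨b'', hb'', hz'b''⟩ := exists_notMem_of_mem_classA3 h hz'
          exact (pair_eq_of_card_rest_le_one h hc (sdiff_mem_diffs (mem_F_of_mem_s h ha') (mem_F_of_mem_t h hb'')) hW0
            (Finset.mem_sdiff.2 ⟨hwa', notMem_of_mem_classA6 hw hb''⟩)
            (Finset.mem_sdiff.2 ⟨mem_of_mem_classA3 hz' ha', hz'b''⟩) hwW hzW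
            (Finset.mem_union_right _ hw) (Finset.mem_union_left _ hz')
            (Finset.mem_union_right _ hw) (Finset.mem_union_left _ hz)).2
        -- `z` lies in some `b₁`, whose trace is `{z} = A₃`
        obtain ⟨b₁, hb₁, hzb₁⟩ := exists_mem_of_mem_classA3 hz
        apply hS
        refine Finset.mem_image.2 ⟨b₁, hb₁, ?_⟩
        ext r
        simp only [Finset.mem_inter, Finset.mem_union]
        constructor
        · rintro ⟨-, hr3 | hr4⟩
          · exact hr3
          · exact absurd hr4 (h4 r)
        · intro hr
          exact ⟨by rw [hA3u r hr]; exact hzb₁, Or.inl hr⟩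
      · -- `A₃ = ∅`: the trace of `b₀` is `∅ = A₃`
        push Not at h3
        apply hS
        refine Finset.mem_image.2 ⟨b₀, hb₀, ?_⟩
        ext r
        simp only [Finset.mem_inter, Finset.mem_union]
        constructor
        · rintro ⟨-, hr3 | hr4⟩
          · exact hr3
          · exact absurd hr4 (h4 r)
        · intro hr
          exact absurd hr (h3 r)
  · -- (c3): `A₅ = ∅`, so `X = A₃`
    push Not at h5
    have hXA3 : ∀ r, r ∈ X ↔ r ∈ classA3 u s t := by
      intro r
      rw [hXmem]
      constructor
      · rintro (h3 | h5')
        · exact h3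
        · exact absurd h5' (h5 r)
      · exact Or.inl
    by_cases h6 : ∃ w, w ∈ classA6 u s t
    · obtain ⟨w, hw⟩ := h6
      obtain ⟨a', ha', hwa'⟩ := exists_mem_of_mem_classA6 h hw
      -- `A₃ ≠ ∅` (else `X = ∅` would be a difference)
      have hA3 : ∃ z, z ∈ classA3 u s t := by
        by_contra hno
        push Not at hno
        have hXe : X = ∅ := Finset.eq_empty_of_forall_notMem fun r hr => hno r ((hXA3 r).1 hr)
        exact h.notMem X (mem_F_of_mem_s h hX) (by rw [hXe]; exact empty_mem_diffs h)
      obtain ⟨z, hz⟩ := hA3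
      obtain ⟨b', hb', hzb'⟩ := exists_notMem_of_mem_classA3 h hz
      have hW0 : a' \ b' ∈ F \\ F :=
        sdiff_mem_diffs (mem_F_of_mem_s h ha') (mem_F_of_mem_t h hb')
      have hwW : w ∈ a' \ b' := Finset.mem_sdiff.2 ⟨hwa', notMem_of_mem_classA6 hw hb'⟩
      have hzW : z ∈ a' \ b' := Finset.mem_sdiff.2 ⟨mem_of_mem_classA3 hz ha', hzb'⟩
      have hA3u : ∀ z' ∈ classA3 u s t, z' = z := by
        intro z' hz'
        obtain ⟨b'', hb'', hz'b''⟩ := exists_notMem_of_mem_classA3 h hz'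
        exact (pair_eq_of_card_rest_le_one h hc (sdiff_mem_diffs (mem_F_of_mem_s h ha') (mem_F_of_mem_t h hb'')) hW0
          (Finset.mem_sdiff.2 ⟨hwa', notMem_of_mem_classA6 hw hb''⟩)
          (Finset.mem_sdiff.2 ⟨mem_of_mem_classA3 hz' ha', hz'b''⟩) hwW hzW
          (Finset.mem_union_right _ hw) (Finset.mem_union_left _ hz')
          (Finset.mem_union_right _ hw) (Finset.mem_union_left _ hz)).2
      -- intersecting: `X ∩ b′ ≠ ∅`, but `X = A₃ = {z}` and `z ∉ b′`
      obtain ⟨y, hy⟩ := inter_nonempty h hX hb'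
      obtain ⟨hyX, hyb'⟩ := Finset.mem_inter.1 hy
      rw [hA3u y ((hXA3 y).1 hyX)] at hyb'
      exact hzb' hyb'
    · -- `A₆ = ∅`: the residual case `s = {X}` — Step 5
      push Not at h6
      have hR : ∀ c : Finset α, c ∩ (classA5 u s t ∪ classA6 u s t) = ∅ := fun c =>
        Finset.eq_empty_of_forall_notMem fun r hr => by
          rcases Finset.mem_union.1 (Finset.mem_inter.1 hr).2 with h5' | h6'
          · exact h5 r h5'
          · exact h6 r h6'
      have hsX : s = {X} := by
        rw [Finset.eq_singleton_iff_unique_mem]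
        refine ⟨hX, fun a ha => ?_⟩
        rw [mem_s_eq h ha, mem_s_eq h hX, hR a, hR X]
      have hsp : IsSplit F {X} t := by rw [← hsX]; exact h.split
      have hXc : ∀ r ∈ u, r ∉ X → ∃ b ∈ t, r ∉ b := by
        intro r hr hrX
        rcases mem_classes h hr with h1 | h2 | h3 | h4 | h5' | h6'
        · exact absurd h1 (hA1e r)
        · exact absurd h2 (hA2e r)
        · exact absurd ((hXA3 r).2 h3) hrX
        · exact exists_notMem_of_mem_classA4 h4
        · exact absurd h5' (h5 r)
        · exact absurd h6' (h6 r)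
      obtain ⟨a, ha, b, hb, hab⟩ := cover_of_single_side h.support hsp h.down h.sing h.notMem h.exc
        (fun r hr => exists_notMem_of_mem_classA3 h ((hXA3 r).1 hr)) hXc
      exact hnc a ha b hb hab

end CaseIota

end PercRepro.MSTight
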